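import Summits.QuantumFields.BalabanUV.Beta.GAN24.AliasFibreBridge
import Summits.QuantumFields.BalabanUV.Beta.GAN24.FibreArrowBZ
import Summits.QuantumFields.BalabanUV.Beta.GAN24.AliasWeights

/-!
# `BalabanUV.Beta.GAN24.ArrowAnchorZeroMomenta` — binder row G-an2-4 / (CONV-C), road P1-fibre, p1 row **P1-L10** `FibreStrip` ((I3′)), L10 owner leaf-16's
# cut «(M4) scaled alias-space Neumann» (= SKELETON-P1 A5 v0.3), row **F3** `ArrowAnchorZero` (INNER ANCHOR at `p = 0`), part 1 = the `p = 0` ALIAS DATA that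
# does NOT depend on F1's `ArrowOperator`/`ArrowScaling` currency: the border weights of the arrow system VANISH off the zero alias, so at `p = 0` the system
# DECOUPLES into the nonzero-alias KKT blocks and the pinned zero-alias sector

NOT IN PRINT; OUR PROOF ATTEMPT.  HONEST FRAMING (cell contract, verbatim): «discharging `BetaPertH` makes Bałaban's UV stability UNCONDITIONAL — a real
constructive-QFT result; it is NOT the continuum limit and NOT the Clay problem.»  HONEST DEPENDENCY (verbatim): «continuum YM on T⁴ ⇐ BetaPertH ∧ nine spine
estimates (0/9 proved); BetaPertH ⇐ (D1) ∧ (D4) ∧ CAP+tail; G-an2-4 gates asym, D1 and NE2/3/4.»  [folklore] finite trigonometric sums (`GAN24/AliasObjects`,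
`GAN24/AliasWeights.geomExp_mul_sub_one`, `GAN24/AliasFibreBridge`, `GAN24/FibreArrowBZ` BY NAME); no cited fact, no `def`, no `def … : Prop` hypothesis, no wall
binder.  NOT summit progress: nothing of (CONV-C)'s K-slot `GAN24.CombesThomas.ConvCK 3 Lc` is discharged here; NOT `BetaPertH`, NOT continuum, NOT Clay.

## What is proved (generic `D`, `N ≥ 1`; `p = 0`; aliases `m ∈ (ℤ/N)^D`; T00 currency `AliasObjects.gs/sAl/sbAl/SAl/SbAl/chiAl/wAl`, leaf-06's `FibreArrow.chiHat/sflat/boxS/boxSs`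
## = the raw weights of F1a's `ArrowOperator.aliasArrow N 0`)
* §1 GEOMETRIC SUMS AT THE `p = 0` ALIAS MOMENTA (`gs 0 n = n` is leaf-07's `SourceSidePair.gs_zero`, inlined here to keep the import cone small); for `0 < r < N`, `e^{±2πir/N} ≠ 1` and `gs (±2πr/N) N = 0` (`geomExp_mul_sub_one`); `kFine 0 m κ = 2π·val(m κ)/N`;
  hence **`sAl_zero`**/**`sbAl_zero`**: `sAl N 0 m κ = N` on a passive coordinate (`m κ = 0`) and `= 0` on an active one.
* §2 **THE BORDER WEIGHTS VANISH OFF THE ZERO ALIAS**: for `m ≠ 0`, `SAl N 0 m = SbAl N 0 m = chiAl N 0 m = wAl N 0 m = 0` and, in `FibreArrow` currency,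
  `boxS 0 m = 0` (M-row weight of `μ̂(m)`), `chiHat 0 m = 0` (G-row weight of `c`), `boxSs 0 m κ = 0` (Q-row weight of `Â_κ(m)`), `chiHat 0 m · sflat 0 m κ = 0` (EL-row
  weight of `φ_κ`); the `m = 0` values in T00 currency (`SAl_zero_zero = N^D`, `SbAl_zero_zero = N^D`, `chiAl_zero_zero = 1`; the `FibreArrow` ones are
  `FibreArrowBZ.boxS_zero_zero`/`boxSs_zero_zero`/`chiHat_zero_zero`/`sflat_zero_zero` BY NAME) and the DECOUPLED GLOBAL ROWS `sum_boxSs_zero_mul`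
  (`Σ_m boxSs 0 m κ · A m κ = N^{D+1} · A 0 κ`), `sum_boxS_zero_mul` (`Σ_m boxS 0 m · μ m = N^D · μ 0`).
So at `p = 0` the arrow matrix is `blockDiagonal (T(k_m))_{m ≠ 0}` ⊕ the signed coupling {EL(0) ↔ φ, G(0) ↔ c, Q ↔ Â(0), M ↔ μ̂(0)} with weights `N, 1, N^{D+1}, N^D`
(all `1` in leaf-16's inner scaling) and `T(k_0) = T(0) = 0` (`FibreArrowBZ.dhat_zero/dflat_zero/lapSym_zero`); part 2 of row F3 (`GAN24/ArrowAnchorZero`: the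
explicit decoupled inverse, `‖(arrowMat (innerArrow N 0))⁻¹‖ ≤ 5/2` from `ArrowUnitBlock.isUnit_and_norm_inv_unitKKT_le`) is typed against F1c `ArrowScaling`.
Unit `b2b-balaban-gan24-formalise-leaf-15` (G-an2-4 formalisation swarm; `CLAIM P1-L10-F3` 2026-08-20T00:42Z), 2026-08-20.  Value = anchor data for L10's route
(M4); NOT (I3′), NOT the K-slot.
-/

noncomputable section

open Finset Complex
open scoped BigOperators Real
open Literature.Probability.LatticeModels (TorusSite)
open Literature.MathematicalPhysics.QuantumFieldTheory.LatticeForm (repZ)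

namespace Summit.QuantumFields.BalabanUV.Beta.GAN24.ArrowAnchorZeroMomenta

open FibreDFT (kFine)
open FibreArrow (chiHat sflat boxS boxSs)
open AliasObjects (gs sAl sbAl SAl SbAl chiAl wAl kAl LAl)
open AliasFibreBridge (boxS_eq_SAl chiHat_eq_chiAl boxSs_eq_SAl_mul_sAl sflat_eq_sbAl)
open AliasWeights (geomExp_mul_sub_one)

variable {D N : ℕ} [NeZero N]

/-! ## §1 Geometric sums at the `p = 0` alias momenta -/

/-- [folklore] `e^{iz}` with `z = 2πr/N`, `0 < r < N`, is NOT `1`. -/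
theorem cexp_two_pi_div_ne_one {r : ℕ} (h0 : 0 < r) (hr : r < N) : cexp (I * (2 * π * r / N)) ≠ 1 := by
  intro h
  obtain ⟨n, hn⟩ := Complex.exp_eq_one_iff.mp h
  have hN : (N : ℂ) ≠ 0 := Nat.cast_ne_zero.2 (NeZero.ne N)
  have hπ : (2 * π * I : ℂ) ≠ 0 := by simp [Real.pi_ne_zero]
  have e : ((r : ℂ)) = (n : ℂ) * N := by
    have h1 : I * (2 * π * r / N) * N = n * (2 * π * I) * N := by rw [hn]
    field_simp at h1
    linear_combination h1
  have e' : (r : ℤ) = n * N := by exact_mod_cast e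
  have h3 : (0 : ℤ) < n * N := by rw [← e']; exact_mod_cast h0
  have h4 : n * (N : ℤ) < N := by rw [← e']; exact_mod_cast hr
  have hNpos : (0 : ℤ) < N := by exact_mod_cast Nat.pos_of_ne_zero (NeZero.ne N)
  have hn1 : 0 < n := pos_of_mul_pos_left h3 hNpos.le
  nlinarith

/-- [folklore] The same for the reflected momentum `−2πr/N`. -/
theorem cexp_neg_two_pi_div_ne_one {r : ℕ} (h0 : 0 < r) (hr : r < N) : cexp (I * (-(2 * π * r / N))) ≠ 1 := by
  intro h
  apply cexp_two_pi_div_ne_one (N := N) h0 hr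
  have e : I * (2 * π * r / N) = -(I * (-(2 * π * (r : ℂ) / N))) := by ring
  rw [e, Complex.exp_neg, h, inv_one]

omit [NeZero N] in
/-- [folklore] `gs z N = 0` as soon as `e^{izN} = 1` but `e^{iz} ≠ 1` (the geometric-sum identity `gs·(e^{iz} − 1) = e^{izN} − 1`). -/
theorem gs_eq_zero_of_cexp {z : ℂ} (h1 : cexp (I * z) ≠ 1) (hN : cexp (I * z * N) = 1) : gs z N = 0 := by
  have h := geomExp_mul_sub_one z N
  rw [hN, sub_self] at h
  exact (mul_eq_zero.mp h).resolve_right (sub_ne_zero.mpr h1)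

/-- [folklore] `gs (2πr/N) N = 0` for `0 < r < N`. -/
theorem gs_two_pi_div_eq_zero {r : ℕ} (h0 : 0 < r) (hr : r < N) : gs (2 * π * r / N) N = 0 := by
  refine gs_eq_zero_of_cexp (cexp_two_pi_div_ne_one (N := N) h0 hr) ?_
  have hN : (N : ℂ) ≠ 0 := Nat.cast_ne_zero.2 (NeZero.ne N)
  have e : I * (2 * π * (r : ℂ) / N) * N = (r : ℂ) * (2 * π * I) := by field_simp
  rw [e]
  exact_mod_cast Complex.exp_nat_mul_two_pi_mul_I r

/-- [folklore] `gs (−2πr/N) N = 0` for `0 < r < N`. -/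
theorem gs_neg_two_pi_div_eq_zero {r : ℕ} (h0 : 0 < r) (hr : r < N) : gs (-(2 * π * r / N)) N = 0 := by
  refine gs_eq_zero_of_cexp (cexp_neg_two_pi_div_ne_one (N := N) h0 hr) ?_
  have hN : (N : ℂ) ≠ 0 := Nat.cast_ne_zero.2 (NeZero.ne N)
  have e : I * (-(2 * π * (r : ℂ) / N)) * N = -((r : ℂ) * (2 * π * I)) := by field_simp
  rw [e, Complex.exp_neg]
  have h := Complex.exp_nat_mul_two_pi_mul_I r
  rw [h, inv_one]

omit [NeZero N] in
/-- [folklore] The fine momentum at `p = 0`: `kFine 0 m κ = 2π·(m κ).val/N`. -/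
theorem kFine_zero_apply (m : TorusSite D N) (κ : Fin D) : kFine (0 : Fin D → ℂ) m κ = 2 * π * ((m κ).val : ℕ) / N := by
  simp only [kFine, Pi.zero_apply, zero_add, repZ, Int.cast_natCast]

/-- [folklore] **THE CONTOUR WEIGHT AT `p = 0`**: `sAl N 0 m κ = N` on a passive coordinate (`m κ = 0`) and `= 0` on an active one. -/
theorem sAl_zero (m : TorusSite D N) (κ : Fin D) : sAl N (0 : Fin D → ℂ) m κ = if m κ = 0 then (N : ℂ) else 0 := by
  unfold sAl kAl
  rw [kFine_zero_apply]
  split_ifs with h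
  · rw [h, ZMod.val_zero, Nat.cast_zero, mul_zero, zero_div]
    unfold gs; simp
  · have h0 : 0 < (m κ).val := Nat.pos_of_ne_zero fun h0 => h ((ZMod.val_eq_zero _).1 h0)
    exact gs_two_pi_div_eq_zero h0 (ZMod.val_lt (m κ))

/-- [folklore] The reflected contour weight at `p = 0`: the same dichotomy. -/
theorem sbAl_zero (m : TorusSite D N) (κ : Fin D) : sbAl N (0 : Fin D → ℂ) m κ = if m κ = 0 then (N : ℂ) else 0 := by
  unfold sbAl kAl
  rw [kFine_zero_apply]
  split_ifs with h
  · rw [h, ZMod.val_zero, Nat.cast_zero, mul_zero, zero_div, neg_zero]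
    unfold gs; simp
  · have h0 : 0 < (m κ).val := Nat.pos_of_ne_zero fun h0 => h ((ZMod.val_eq_zero _).1 h0)
    exact gs_neg_two_pi_div_eq_zero h0 (ZMod.val_lt (m κ))

/-! ## §2 The border weights vanish off the zero alias -/

omit [NeZero N] in
/-- [folklore] A nonzero alias has an active coordinate. -/
theorem exists_ne_zero_of_ne_zero {m : TorusSite D N} (hm : m ≠ 0) : ∃ i, m i ≠ 0 := by
  by_contra h
  exact hm (funext fun i => by simpa using (not_exists.1 h) i)

/-- [folklore] **`S(m) = 0` at `p = 0` for `m ≠ 0`.** -/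
theorem SAl_zero_of_ne_zero {m : TorusSite D N} (hm : m ≠ 0) : SAl N (0 : Fin D → ℂ) m = 0 := by
  obtain ⟨i, hi⟩ := exists_ne_zero_of_ne_zero hm
  unfold SAl
  exact Finset.prod_eq_zero (Finset.mem_univ i) (by rw [sAl_zero, if_neg hi])

/-- [folklore] **`S♭(m) = 0` at `p = 0` for `m ≠ 0`.** -/
theorem SbAl_zero_of_ne_zero {m : TorusSite D N} (hm : m ≠ 0) : SbAl N (0 : Fin D → ℂ) m = 0 := by
  obtain ⟨i, hi⟩ := exists_ne_zero_of_ne_zero hm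
  unfold SbAl
  exact Finset.prod_eq_zero (Finset.mem_univ i) (by rw [sbAl_zero, if_neg hi])

/-- [folklore] `χ̂(m) = 0` at `p = 0` for `m ≠ 0`. -/
theorem chiAl_zero_of_ne_zero {m : TorusSite D N} (hm : m ≠ 0) : chiAl N (0 : Fin D → ℂ) m = 0 := by
  unfold chiAl
  rw [SbAl_zero_of_ne_zero hm, zero_div]

/-- [folklore] `w(m) = S(m)χ̂(m) = 0` at `p = 0` for `m ≠ 0`. -/
theorem wAl_zero_of_ne_zero {m : TorusSite D N} (hm : m ≠ 0) : wAl N (0 : Fin D → ℂ) m = 0 := by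
  unfold wAl
  rw [SAl_zero_of_ne_zero hm, zero_mul]

/-- [folklore] `S(0) = N^D` at `p = 0` (T00 currency; `FibreArrowBZ.boxS_zero_zero` in `FibreArrow` currency). -/
theorem SAl_zero_zero : SAl N (0 : Fin D → ℂ) (0 : TorusSite D N) = (N : ℂ) ^ D := by
  unfold SAl
  simp [sAl_zero]

/-- [folklore] `S♭(0) = N^D` at `p = 0`. -/
theorem SbAl_zero_zero : SbAl N (0 : Fin D → ℂ) (0 : TorusSite D N) = (N : ℂ) ^ D := by
  unfold SbAl
  simp [sbAl_zero]

/-- [folklore] `χ̂(0) = 1` at `p = 0` (T00 currency). -/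
theorem chiAl_zero_zero : chiAl N (0 : Fin D → ℂ) (0 : TorusSite D N) = 1 := by
  unfold chiAl
  rw [SbAl_zero_zero]
  exact div_self (pow_ne_zero _ (Nat.cast_ne_zero.2 (NeZero.ne N)))

/-- [folklore] **IN `FibreArrow` CURRENCY** (the weights of `aliasFibre`/row F1's `aliasArrow`): `boxS 0 m = 0` for `m ≠ 0` (the M-row weight of `μ̂(m)`). -/
theorem boxS_zero_of_ne_zero {m : TorusSite D N} (hm : m ≠ 0) : boxS (0 : Fin D → ℂ) m = 0 := by
  rw [boxS_eq_SAl, SAl_zero_of_ne_zero hm]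

/-- [folklore] `chiHat 0 m = 0` for `m ≠ 0` (the G-row weight of `c` and the prefactor of the EL-row weight of `φ`). -/
theorem chiHat_zero_of_ne_zero {m : TorusSite D N} (hm : m ≠ 0) : chiHat (0 : Fin D → ℂ) m = 0 := by
  rw [chiHat_eq_chiAl, chiAl_zero_of_ne_zero hm]

/-- [folklore] `boxSs 0 m κ = 0` for `m ≠ 0` (the Q-row weight of `Â_κ(m)`). -/
theorem boxSs_zero_of_ne_zero {m : TorusSite D N} (hm : m ≠ 0) (κ : Fin D) : boxSs (0 : Fin D → ℂ) m κ = 0 := by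
  rw [boxSs_eq_SAl_mul_sAl, SAl_zero_of_ne_zero hm, zero_mul]

/-- [folklore] `chiHat 0 m · sflat 0 m κ = 0` for `m ≠ 0` (the EL-row weight of `φ_κ`). -/
theorem chiHat_mul_sflat_zero_of_ne_zero {m : TorusSite D N} (hm : m ≠ 0) (κ : Fin D) : chiHat (0 : Fin D → ℂ) m * sflat (0 : Fin D → ℂ) m κ = 0 := by
  rw [chiHat_zero_of_ne_zero hm, zero_mul]

/-- [folklore] **DECOUPLING OF THE Q ROWS AT `p = 0`**: `Σ_m boxSs 0 m κ · A m κ = N^{D+1} · A 0 κ` — only the zero alias is seen. -/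
theorem sum_boxSs_zero_mul (A : TorusSite D N → Fin D → ℂ) (κ : Fin D) :
    ∑ m, boxSs (0 : Fin D → ℂ) m κ * A m κ = (N : ℂ) ^ (D + 1) * A 0 κ := by
  rw [Finset.sum_eq_single (0 : TorusSite D N) (fun m _ hm => by rw [boxSs_zero_of_ne_zero hm, zero_mul]) (fun h => absurd (Finset.mem_univ _) h),
    FibreArrowBZ.boxSs_zero_zero]

/-- [folklore] **DECOUPLING OF THE M ROW AT `p = 0`**: `Σ_m boxS 0 m · μ m = N^D · μ 0`. -/
theorem sum_boxS_zero_mul (μ : TorusSite D N → ℂ) : ∑ m, boxS (0 : Fin D → ℂ) m * μ m = (N : ℂ) ^ D * μ 0 := by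
  rw [Finset.sum_eq_single (0 : TorusSite D N) (fun m _ hm => by rw [boxS_zero_of_ne_zero hm, zero_mul]) (fun h => absurd (Finset.mem_univ _) h),
    FibreArrowBZ.boxS_zero_zero]


end Summit.QuantumFields.BalabanUV.Beta.GAN24.ArrowAnchorZeroMomenta

end
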